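import Literature.Probability.RandomPlanarGeometry.ConformalRestrictionUniqueOne
import Literature.Probability.RandomPlanarGeometry.BrownianExcursionRestriction
import HarnessLib

/-!
# Discharges of `LawlerSchrammWerner2003` and `LawlerSchrammWerner2003_unique` ([LSW] p. 5 result 2)

Proof-only file (no definition, no named fact), after

* G. F. Lawler, O. Schramm, W. Werner, *Conformal restriction: the chordal case*, J. Amer.
  Math. Soc. **16** (2003) 917–955, arXiv:math/0209343 (**[LSW]**, arXiv page numbers): p. 5
  result 2 (chordal restriction measures carried by simple curves are SLE_{8/3}, existence and
  uniqueness); Prop. 3.3 (p. 10); §4 Prop. 4.1 (p. 16) and the sentence following its proof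
  ("We have just proved that the two-sided restriction measure `P_1` exists"); Thm. 6.1
  (p. 23); §8.1–8.2, Cor. 8.6 (pp. 37–38).

STATE OF THE TREE (2026-08-15). `OneSidedExcursionCloudInterior` reduced p. 5 result 2 to
`∃ P, IsRestrictionMeasure 1 P` (`LawlerSchrammWerner2003_of_exists_one`), and
`ConformalRestrictionUniqueOne` did the same for its uniqueness half
(`LawlerSchrammWerner2003_unique_of_exists_one`); `BrownianExcursionRestriction` has PROVED
[LSW] Prop. 4.1 for the Brownian excursion realised by a four-dimensional Brownian motion,
whence `exists_isRestrictionMeasure_one_brownianQuad : ∃ P, IsRestrictionMeasure 1 P` and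
`LawlerSchrammWerner2003_brownianQuad`. This file records the two discharges under their
`_holds` names:

* `LawlerSchrammWerner2003_holds` — **p. 5 result 2**: a chordal, conformally covariant family
  with hull restriction carried by simple curves is chordal SLE_{8/3} (the term
  `LawlerSchrammWerner2003_brownianQuad`);
* `LawlerSchrammWerner2003_unique_holds` — **p. 5 result 2, uniqueness**: two such families
  agree on every Dobrushin domain.

(The sibling discharges from `P_1` — Prop. 8.1, Cor. 8.6, both readings of "the only `P_α`
supported on simple curves is `P_{5/8}`", and "for `α > 5/8`, `P_α`-a.e. `K` has an interior
point" — are in `OneSidedRestrictionHolds`, `RestrictionMeasuresSimpleHolds` and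
`RestrictionMeasuresFiveEighthsHolds`.)

## References

* [LSW] p. 5 result 2; Prop. 3.3; Prop. 4.1 (p. 16); Thm. 6.1 (p. 23); Cor. 8.6 (pp. 37–38).
  [LawlerSchrammWerner2003Restriction]
* G. F. Lawler, *Conformally Invariant Processes in the Plane*, AMS (2005), §9.2 Prop. 9.13,
  Cor. 9.11. [Lawler2005]
-/

noncomputable section

namespace Literature.Probability.RandomPlanarGeometry

/-- **[LSW] p. 5 result 2: a chordal, conformally covariant family with hull restriction that
is carried by simple curves is chordal SLE_{8/3}** — the discharge of `LawlerSchrammWerner2003`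
(definitionally `LawlerSchrammWerner2003_brownianQuad`: `P_1` by Prop. 4.1, `α = 5/8` by the
one-sided route of §8, then Prop. 3.3 and Thm. 6.1).
[cite: LawlerSchrammWerner2003Restriction, p. 5 result 2; Prop. 3.3, Prop. 4.1, Thm. 6.1, Cor. 8.6] -/
theorem LawlerSchrammWerner2003_holds : LawlerSchrammWerner2003 :=
  LawlerSchrammWerner2003_brownianQuad

/-- **[LSW] p. 5 result 2, uniqueness: two chordal, conformally covariant families with hull
restriction carried by simple curves agree on every Dobrushin domain.**
[cite: LawlerSchrammWerner2003Restriction, p. 5 result 2; Prop. 3.3, Lemma 3.2, Prop. 4.1, Cor. 8.6] -/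
theorem LawlerSchrammWerner2003_unique_holds : LawlerSchrammWerner2003_unique :=
  LawlerSchrammWerner2003_unique_of_exists_one exists_isRestrictionMeasure_one_brownianQuad

end Literature.Probability.RandomPlanarGeometry

end
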